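import Summits.RiemannHypothesis.RiemannHypothesis.Theorems.ThetaTier2Stage2
import HarnessLib

/-!
# THETA tier-2 kernel checker — soundness of the LAYER REMAINDER `rTerm` and of the GAIN `gainLo` (cc-s2-1, WEIL typing lane; RH-FREE)

(K5)/(K6) of HOME/cc-s2-1/gen22/TIER2-KERNEL-SPEC.md §5 / §6(d).

* (K5) `rTerm A (stage1 A) = (2 log q/√q)·(rA·M_L·χ_L + rB·M_L²·χ_L²)` rounded up, with the CELLWISE layer majorant
  `M_L = M₀·sLayer·e^{m(2δ−η′)}`, `sLayer = max_{j0 ≤ j < j1p} S_j` (`listMax` over the window of the re-reversed `S`-list, or `ζ(m+1)` when the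
  window is empty): `sLayerN`, `envS_le_sLayerN` (every windowed cell value is below it), `stage1_layer_le` (hence `S(t) ≤ val sLayerN` for every
  `t ∈ [j0·τ, j1p·τ]`, the closed cells covering the bottom layer), and `rTerm_sound`: for any reals below the atoms,
  `r̄c·(r̄A·M·χ + r̄B·M²·χ²) ≤ val (rTerm A (stage1 A))` whenever `0 ≤ M ≤ val (mulU (mulU M0 sLayerN) emL)` (`layerM_le` supplies this from
  `M₀ ≤ val M0`, `s ≤ val sLayerN`, `e^{m(2δ−η′)} ≤ val emL`).
* (K6) `val (gainLo A) ≤ 2·L·(2·Σ_{j<|gainPairs|} d·Ra_j·Rb_j)` for any reals `L ≥ val logqL`, `d ≥ val dJ`, `Ra_j ≥ val a_j`, `Rb_j ≥ val b_j`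
  (`gainLo_sound`) — with `Ra_j = R(τ₁(w_j))`, `Rb_j = R(τ₁(2δ − w_{j+1}))`, `d = δ/J`, `L = log q` this is `≤ 2 log q · I_lo(J) = P.gain J`
  of `WeilColumnThetaWitness` (THETA-CERT-cc6 D8; the pairs' meaning is the atoms layer's data fact).

Nothing here bears on the truth of RH.
-/

set_option linter.dupNamespace false  -- the mandated namespace repeats `RiemannHypothesis`
set_option autoImplicit false

namespace Summit.RiemannHypothesis.RiemannHypothesis.Theorems.ThetaTier2

open Real Finset

/-! ## `listMax` -/

/-- `listMax [] acc = acc`. [this cell] -/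
theorem listMax_nil (acc : ℕ) : listMax [] acc = acc := by
  unfold listMax; rfl

/-- `listMax (x :: xs) acc = listMax xs (max x acc)`. [this cell] -/
theorem listMax_cons (x : ℕ) (xs : List ℕ) (acc : ℕ) : listMax (x :: xs) acc = listMax xs (max x acc) := by
  conv => lhs; unfold listMax

/-- The floor is below the maximum. [this cell] -/
theorem le_listMax_acc : ∀ (l : List ℕ) (acc : ℕ), acc ≤ listMax l acc := by
  intro l
  induction l with
  | nil => intro acc; rw [listMax_nil]
  | cons x xs ih => intro acc; rw [listMax_cons]; exact le_trans (le_max_right x acc) (ih _)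

/-- Every member is below the maximum. [this cell] -/
theorem le_listMax_of_mem : ∀ (l : List ℕ) (acc : ℕ), ∀ x ∈ l, x ≤ listMax l acc := by
  intro l
  induction l with
  | nil => intro acc x hx; simp at hx
  | cons y ys ih =>
    intro acc x hx
    rw [listMax_cons]
    rcases List.mem_cons.1 hx with rfl | hx'
    · exact le_trans (le_max_left x acc) (le_listMax_acc ys _)
    · exact ih _ x hx'

/-! ## The layer majorant `sLayer` -/

/-- The kernel's layer value `sLayer` for the run `stage1 A`: the maximum of `S_j` over the window `j0 ≤ j < j1p`, or `ζ(m+1)` (`zm1H`) when the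
window is empty (`2δ > η′`). [this cell, TIER2-KERNEL-SPEC §2 (layer remainder)] -/
def sLayerN (A : Inp) : ℕ :=
  if A.j1p > A.j0 then listMax ((((stage1 A).sRev.reverse).drop A.j0).take (A.j1p - A.j0)) 0 else A.zm1H

/-- Empty window: `sLayerN A = A.zm1H`. [this cell] -/
theorem sLayerN_of_not_lt (A : Inp) (h : ¬ A.j0 < A.j1p) : sLayerN A = A.zm1H := by
  unfold sLayerN; rw [if_neg h]

/-- **Every windowed cell value is below `sLayer`**: `j0 ≤ j < j1p`, `j < Jt` ⇒ `envS A j ≤ val (sLayerN A)`. [this cell, TIER2-KERNEL-SPEC §5 (K5)] -/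
theorem envS_le_sLayerN (A : Inp) {j : ℕ} (h0 : A.j0 ≤ j) (h1 : j < A.j1p) (hJ : j < A.Jt) : envS A j ≤ val (sLayerN A) := by
  have hlt : A.j0 < A.j1p := lt_of_le_of_lt h0 h1
  unfold sLayerN envS
  rw [if_pos hlt]
  apply val_mono
  apply le_listMax_of_mem
  set sl := (stage1 A).sRev.reverse with hsl
  have hlen : sl.length = A.Jt := by rw [hsl, List.length_reverse, (stage1_lengths A).1]
  have hj : j < sl.length := by rw [hlen]; exact hJ
  rw [List.mem_iff_getElem?]
  refine ⟨j - A.j0, ?_⟩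
  rw [List.getElem?_take_of_lt (by omega), List.getElem?_drop, show A.j0 + (j - A.j0) = j by omega,
    List.getD_eq_getElem?_getD, List.getElem?_eq_getElem hj, Option.getD_some]

/-- The closed cells `j0, …, j1p − 1` cover `[j0·τ, j1p·τ]`. [folklore] -/
theorem exists_layer_cell (A : Inp) (hj : A.j0 < A.j1p) {τ t : ℝ} (hτ : 0 < τ) (h1 : (A.j0 : ℝ) * τ ≤ t)
    (h2 : t ≤ (A.j1p : ℝ) * τ) : ∃ j : ℕ, A.j0 ≤ j ∧ j < A.j1p ∧ (j : ℝ) * τ ≤ t ∧ t ≤ ((j : ℝ) + 1) * τ := by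
  have ht0 : 0 ≤ t / τ := div_nonneg (le_trans (by positivity) h1) hτ.le
  set n := ⌊t / τ⌋₊ with hn
  have hn1 : (n : ℝ) ≤ t / τ := Nat.floor_le ht0
  have hn2 : t / τ < n + 1 := Nat.lt_floor_add_one _
  have hj0n : A.j0 ≤ n := by
    have : (A.j0 : ℝ) ≤ t / τ := by rw [le_div_iff₀ hτ]; exact h1
    have : (A.j0 : ℝ) < n + 1 := lt_of_le_of_lt this hn2
    have : (A.j0 : ℝ) < ((n + 1 : ℕ) : ℝ) := by push_cast; exact this
    exact Nat.lt_succ_iff.1 (by exact_mod_cast this)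
  by_cases hlt : n < A.j1p
  · refine ⟨n, hj0n, hlt, ?_, ?_⟩
    · have := (le_div_iff₀ hτ).1 hn1; linarith
    · have := (div_lt_iff₀ hτ).1 hn2; linarith
  · -- `t/τ ≥ j1p`, so with `t ≤ j1p·τ`: `t = j1p·τ`, covered by the last cell `j1p − 1`
    refine ⟨A.j1p - 1, by omega, by omega, ?_, ?_⟩
    · have hle : (A.j1p : ℝ) ≤ n := by exact_mod_cast (not_lt.1 hlt)
      have : (A.j1p : ℝ) * τ ≤ t := by
        have := (le_div_iff₀ hτ).1 (hle.trans hn1); linarith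
      have hc : ((A.j1p - 1 : ℕ) : ℝ) = (A.j1p : ℝ) - 1 := by rw [Nat.cast_sub (by omega)]; push_cast; ring
      rw [hc]; nlinarith
    · have hc : ((A.j1p - 1 : ℕ) : ℝ) + 1 = (A.j1p : ℝ) := by rw [Nat.cast_sub (by omega)]; push_cast; ring
      rw [hc]; exact h2

/-- **`S(t) ≤ val sLayer` on the whole window `[j0·τ, j1p·τ]`** (`j0 < j1p ≤ Jt`; hypotheses of `stage1_envS_le`).
[this cell, TIER2-KERNEL-SPEC §5 (K5)] -/
theorem stage1_layer_le (A : Inp) {θ₀ τ M₀ M₁₀ c₂ ε R Rm : ℝ} (hA : CellAtoms A θ₀ τ M₀ M₁₀ c₂ ε R Rm)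
    (he : S ≤ A.etL) (heH : S ≤ A.etH) (h1 : val A.th0L ≤ θ₀) (h2 : θ₀ ≤ val A.th0H) (h0 : 0 < A.th0L)
    (hsz : (A.K : ℝ) * val (stage1 A).hi ≤ 2 ^ 24) (hj : A.j0 < A.j1p) (hJ : A.j1p ≤ A.Jt)
    {t : ℝ} (ht1 : (A.j0 : ℝ) * τ ≤ t) (ht2 : t ≤ (A.j1p : ℝ) * τ) :
    Sfun θ₀ R A.m A.K t ≤ val (sLayerN A) := by
  obtain ⟨j, hj0, hj1, hc1, hc2⟩ := exists_layer_cell A hj hA.τ_pos ht1 ht2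
  exact (stage1_envS_le A hA he heH h1 h2 h0 hsz (lt_of_lt_of_le hj1 hJ) hc1 hc2).trans
    (envS_le_sLayerN A hj0 hj1 (lt_of_lt_of_le hj1 hJ))

/-! ## (K5): `rTerm` -/

/-- `rTerm A (stage1 A)` as an explicit expression in `sLayerN A`. [this cell] -/
theorem rTerm_eq (A : Inp) : rTerm A (stage1 A) =
    mulU A.rcoef (mulU (mulU A.rA (mulU (mulU A.M0 (sLayerN A)) A.emL)) A.chiL
      + mulU (mulU (mulU A.rB (mulU (mulU A.M0 (sLayerN A)) A.emL)) (mulU (mulU A.M0 (sLayerN A)) A.emL)) (mulU A.chiL A.chiL)) := by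
  unfold rTerm sLayerN
  dsimp only

/-- The layer majorant product: `M₀·s·e ≤ val (mulU (mulU M0 sLayerN) emL)` for `0 ≤ M₀ ≤ val M0`, `0 ≤ s ≤ val sLayerN`, `0 ≤ e ≤ val emL`.
[this cell, TIER2-KERNEL-SPEC §5 (K5)] -/
theorem layerM_le (A : Inp) {M0r s e : ℝ} (hM : M0r ≤ val A.M0) (hs0 : 0 ≤ s) (hs : s ≤ val (sLayerN A))
    (he0 : 0 ≤ e) (he : e ≤ val A.emL) : M0r * s * e ≤ val (mulU (mulU A.M0 (sLayerN A)) A.emL) :=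
  le_mulU he0 (le_mulU hs0 hM hs) he

/-- **(K5) — the layer remainder**: `r̄c·(r̄A·M·χ + r̄B·M²·χ²) ≤ val (rTerm A (stage1 A))` for any reals `r̄c ≤ val rcoef`, `r̄A ≤ val rA`,
`r̄B ≤ val rB`, `0 ≤ χ ≤ val chiL` and `0 ≤ M ≤ val (mulU (mulU M0 sLayerN) emL)` (D4 with the cellwise `M_L`, v1.1).
[this cell, TIER2-KERNEL-SPEC §5 (K5); THETA-CERT-cc6 D4] -/
theorem rTerm_sound (A : Inp) {rc ra rb M χ : ℝ} (hrc : rc ≤ val A.rcoef) (hra : ra ≤ val A.rA) (hrb : rb ≤ val A.rB)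
    (hM0 : 0 ≤ M) (hM : M ≤ val (mulU (mulU A.M0 (sLayerN A)) A.emL)) (hχ0 : 0 ≤ χ) (hχ : χ ≤ val A.chiL)
    (hra0 : 0 ≤ ra) (hrb0 : 0 ≤ rb) :
    rc * (ra * M * χ + rb * M ^ 2 * χ ^ 2) ≤ val (rTerm A (stage1 A)) := by
  rw [rTerm_eq]
  set ML := mulU (mulU A.M0 (sLayerN A)) A.emL with hML
  have h1 : ra * M ≤ val (mulU A.rA ML) := le_mulU hM0 hra hM
  have h2 : ra * M * χ ≤ val (mulU (mulU A.rA ML) A.chiL) := le_mulU hχ0 h1 hχ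
  have h3 : rb * M ≤ val (mulU A.rB ML) := le_mulU hM0 hrb hM
  have h4 : rb * M * M ≤ val (mulU (mulU A.rB ML) ML) := le_mulU hM0 h3 hM
  have h5 : χ * χ ≤ val (mulU A.chiL A.chiL) := le_mulU hχ0 hχ hχ
  have h6 : rb * M * M * (χ * χ) ≤ val (mulU (mulU (mulU A.rB ML) ML) (mulU A.chiL A.chiL)) :=
    le_mulU (mul_nonneg hχ0 hχ0) h4 h5
  have h7 : ra * M * χ + rb * M ^ 2 * χ ^ 2 ≤
      val (mulU (mulU A.rA ML) A.chiL + mulU (mulU (mulU A.rB ML) ML) (mulU A.chiL A.chiL)) := by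
    rw [val_add]; nlinarith
  have h0 : 0 ≤ ra * M * χ + rb * M ^ 2 * χ ^ 2 := by positivity
  exact le_mulU h0 hrc h7

/-! ## (K6): `gainLo` -/

/-- `gainLoop dJ [] acc = acc`. [this cell] -/
theorem gainLoop_nil (dJ acc : ℕ) : gainLoop dJ [] acc = acc := by
  unfold gainLoop; rfl

/-- One step of `gainLoop`. [this cell] -/
theorem gainLoop_cons (dJ a b : ℕ) (ps : List (ℕ × ℕ)) (acc : ℕ) :
    gainLoop dJ ((a, b) :: ps) acc = gainLoop dJ ps (acc + mulD (mulD dJ a) b) := by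
  conv => lhs; unfold gainLoop

/-- **`gainLoop` rounds DOWN**: `val (gainLoop dJ ps acc) ≤ val acc + Σ_{(a,b) ∈ ps} d·(val a)·(val b)` for `d ≥ val dJ`. [this cell] -/
theorem gainLoop_le {dJ : ℕ} {d : ℝ} (hd : val dJ ≤ d) :
    ∀ (ps : List (ℕ × ℕ)) (acc : ℕ), val (gainLoop dJ ps acc) ≤ val acc + (ps.map fun p => d * val p.1 * val p.2).sum := by
  intro ps
  induction ps with
  | nil => intro acc; rw [gainLoop_nil]; simp
  | cons p ps ih =>
    intro acc
    obtain ⟨a, b⟩ := p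
    rw [gainLoop_cons, List.map_cons, List.sum_cons]
    have h := ih (acc + mulD (mulD dJ a) b)
    rw [val_add] at h
    have ht : val (mulD (mulD dJ a) b) ≤ d * val a * val b := mulD_le (mulD_le hd le_rfl) le_rfl
    dsimp only
    linarith

/-- **(K6) — the gain**: `val (gainLo A) ≤ 2·L·(2·Σ_{j<|gainPairs|} d·Ra_j·Rb_j)` for `L ≥ val logqL`, `d ≥ val dJ`, `Ra_j ≥ val a_j`, `Rb_j ≥ val b_j`
(`(a_j, b_j) = gainPairs[j]`).  With `L = log q`, `d = δ/J` and `Ra_j, Rb_j` the two `R(τ₁(·))` values of D8 the right side is `P.gain J`.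
[this cell, TIER2-KERNEL-SPEC §5 (K6); THETA-CERT-cc6 D8] -/
theorem gainLo_sound (A : Inp) {L d : ℝ} {Ra Rb : ℕ → ℝ} (hL : val A.logqL ≤ L) (hd : val A.dJ ≤ d)
    (ha : ∀ j < A.gainPairs.length, val (A.gainPairs.getD j (0, 0)).1 ≤ Ra j)
    (hb : ∀ j < A.gainPairs.length, val (A.gainPairs.getD j (0, 0)).2 ≤ Rb j) :
    val (gainLo A) ≤ 2 * L * (2 * ∑ j ∈ range A.gainPairs.length, d * Ra j * Rb j) := by
  have hd0 : 0 ≤ d := (val_nonneg _).trans hd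
  -- the loop against the list sum, then the list sum as a range sum over `getD`
  have h1 : val (gainLoop A.dJ A.gainPairs 0) ≤ ∑ j ∈ range A.gainPairs.length,
      d * val (A.gainPairs.getD j (0, 0)).1 * val (A.gainPairs.getD j (0, 0)).2 := by
    have h := gainLoop_le hd A.gainPairs 0
    rw [val_zero, zero_add, ← sum_range_getD (fun p : ℕ × ℕ => d * val p.1 * val p.2) (0, 0)] at h
    exact h
  have h2 : ∑ j ∈ range A.gainPairs.length, d * val (A.gainPairs.getD j (0, 0)).1 * val (A.gainPairs.getD j (0, 0)).2 ≤
      ∑ j ∈ range A.gainPairs.length, d * Ra j * Rb j := by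
    refine sum_le_sum fun j hj => ?_
    have hj' := mem_range.1 hj
    have ha0 := val_nonneg (A.gainPairs.getD j (0, 0)).1
    have e1 : d * val (A.gainPairs.getD j (0, 0)).1 ≤ d * Ra j := mul_le_mul_of_nonneg_left (ha j hj') hd0
    exact mul_le_mul e1 (hb j hj') (val_nonneg _) (mul_nonneg hd0 (ha0.trans (ha j hj')))
  have h3 : val (gainLo A) ≤ val (2 * A.logqL) * val (2 * gainLoop A.dJ A.gainPairs 0) := by
    unfold gainLo; exact mulD_le le_rfl le_rfl
  rw [val_nat_mul, val_nat_mul] at h3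
  push_cast at h3
  have hl0 : 0 ≤ val A.logqL := val_nonneg _
  have hg0 : 0 ≤ val (gainLoop A.dJ A.gainPairs 0) := val_nonneg _
  have hS : val (gainLoop A.dJ A.gainPairs 0) ≤ ∑ j ∈ range A.gainPairs.length, d * Ra j * Rb j := h1.trans h2
  calc val (gainLo A) ≤ 2 * val A.logqL * (2 * val (gainLoop A.dJ A.gainPairs 0)) := h3
    _ ≤ 2 * L * (2 * ∑ j ∈ range A.gainPairs.length, d * Ra j * Rb j) := by
      have hL0 : 0 ≤ L := hl0.trans hL
      exact mul_le_mul (mul_le_mul_of_nonneg_left hL (by norm_num : (0:ℝ) ≤ 2))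
        (mul_le_mul_of_nonneg_left hS (by norm_num : (0:ℝ) ≤ 2)) (mul_nonneg (by norm_num) hg0)
        (mul_nonneg (by norm_num) hL0)

end Summit.RiemannHypothesis.RiemannHypothesis.Theorems.ThetaTier2
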